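import Literature.Combinatorics.Optimization.ShellLawTypeStep
import HarnessLib

/-!
# The exact first and second moments of a block statistic under the shell measure

Cell pnp-psdrank (literature seat g35, on eng g22's MEMO-21 §7 (L1)). Fix a fixed-point-free involution `π`
(a perfect matching), a `π`-stable ground set `S` (`|S| = 2N` vertices, `N` edges), a block `H`, and the shell
`Shell_S(t,c) = {U ⊆ S : |U| = t, |half(U)| = c}` (`c` half-matched vertices, `s = (t−c)/2` full edges) with
the UNIFORM measure. For the block statistic `X = |U ∩ H|`, with `h = |S ∩ H|` and `A = |vAA_S(H)|` (the number
of vertices of `S ∩ H` whose partner is also in `H`, i.e. `2a` for `a` `HH`-edges):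

* **`card_mul_sum_card_inter`** (the mean): `|S| · Σ_{U ∈ Shell} |U∩H| = h·t·|Shell|`, i.e. `E[X] = h t/|S|`
  — no dependence on the level `c`;
* **`sum_card_inter_sq`** (the second moment, MEMO-21 (★)):
  `|S|(|S|−2) · Σ_{U ∈ Shell} |U∩H|² = |Shell| · ( (|S|−2)(t·h + (t−c)·A) + (t(t−1) − (t−c))·(h(h−1) − A) )`,
  i.e. for `|S| = n ≥ 3`: `E[X²] = (t h + (t−c)A)/n + (t(t−1) − (t−c))(h(h−1) − A)/(n(n−2))`
  (`sum_card_inter_sq_div`; with `A = 2a`, `t − c = 2s`, `n = 2N` this is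
  `E[X²] = h t/n + 2a·s/N + (h(h−1) − 2a)(t(t−1) − 2s)/(n(n−2))`).

Proof (eng's "three lines", in counting form, no group action): a vertex `v ∈ S` lies in a cut of the shell
either half-matched or fully matched, and both patterns are counted by shells of the deleted ground set
`S ∖ e_v` (`ShellLawLevelStep.card_shellIn_half/_full`, `ShellLawTypeStep.card_shellIn_half_filter/_full_filter`
with a threaded predicate), whose sizes depend only on `|S| − 2` (`card_shellIn_eq_of_card_eq`); hence
`#{U : v ∈ U}`, `#{U : v, πv ∈ U}` and, for `w ∉ e_v`, `#{U : v, w ∈ U}` do not depend on the vertex / the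
edge / the non-partner pair (§1–§3), and the three constants are fixed by the double counts
`Σ_v [v ∈ U] = t`, `Σ_v [v, πv ∈ U] = t − c`, `Σ_{(v,w) non-partners} [v,w ∈ U] = t(t−1) − (t−c)` per cut (§4).
* **`sum_card_inter_mul_card_inter`** (§5, lit g36; the MIXED moment of two blocks `H₁, H₂`): with
  `h₁₂ = |S ∩ H₁ ∩ H₂|` and `A₁₂ = #{v ∈ S∩H₁ : πv ∈ H₂}`,
  `|S|(|S|−2) · Σ_{U ∈ Shell} |U∩H₁|·|U∩H₂| = |Shell| · ( (|S|−2)(t·h₁₂ + (t−c)·A₁₂) + (t(t−1) − (t−c))·(h₁h₂ − h₁₂ − A₁₂) )`;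
  for disjoint blocks `_of_disjoint`, `_div` (`E[X₁X₂] = s·A₁₂/N + (t(t−1) − 2s)(h₁h₂ − A₁₂)/(n(n−2))`) and the
  covariance `shellCov_of_disjoint`; `card_filter_partner_comm` (`A₁₂ = A₂₁`).

All PROVED, 0 sorry, no definitions, no named facts. Instrument/support material (input of a variance-sensitive
shell tail; eng MEMO-21 §3: the level step changes the variance by `ΔV = −A/(2N)·… ` exactly); nothing here bears
on the crux `TracialDecayExp20`, on psd rank, or on P vs NP.

## References
* [Rothvoss2017] T. Rothvoß, *The matching polytope has exponential extension complexity*, J. ACM 64 (2017),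
  §2 (PDF pp. 5–6): cuts `U`, the partition of `δ(U) ∩ M`, the shells `Q_c`.
* [GodsilMeagher2015] C. Godsil, K. Meagher, *Erdős–Ko–Rado Theorems: Algebraic Approaches* (2015), §15.2
  (perfect matchings; counting by deletion).
-/

noncomputable section

open Finset

namespace Literature.Combinatorics.Optimization

namespace ShellStep

variable {n : ℕ} {π : Fin n → Fin n}

section Moments

variable (hπ : ∀ v, π (π v) = v) (hπ' : ∀ v, π v ≠ v)
include hπ hπ'

/-! ### §1 One vertex: `#{U ∈ Shell_S(t,c) : v ∈ U}` does not depend on `v ∈ S`; the mean -/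

omit hπ hπ' in
/-- Split by the status of the partner: `#{U : v ∈ U} = #{U : v ∈ U, πv ∉ U} + #{U : v, πv ∈ U}`.
[cite: Rothvoss2017, §2 (PDF p. 5)] -/
theorem card_filter_mem_eq_half_add_full (S : Finset (Fin n)) (t c : ℕ) (v : Fin n) :
    ((shellIn π S t c).filter fun U => v ∈ U).card =
      ((shellIn π S t c).filter fun U => v ∈ U ∧ π v ∉ U).card +
        ((shellIn π S t c).filter fun U => v ∈ U ∧ π v ∈ U).card := by
  rw [← card_filter_add_card_filter_not (s := (shellIn π S t c).filter fun U => v ∈ U) (fun U => π v ∉ U),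
    filter_filter, filter_filter]
  simp only [not_not]

/-- The half pattern at `v ∈ S`, all levels: `#{U ∈ Shell_S(t,c) : v ∈ U, πv ∉ U}` is
`|Shell_{S∖e_v}(t−1,c−1)|` if `t, c ≥ 1` and `0` otherwise. [cite: Rothvoss2017, §2 (PDF p. 6)] -/
theorem card_filter_half_eq_ite {S : Finset (Fin n)} {v : Fin n} (hv : v ∈ S) (t c : ℕ) :
    ((shellIn π S t c).filter fun U => v ∈ U ∧ π v ∉ U).card =
      if 1 ≤ t ∧ 1 ≤ c then (shellIn π (S \ {v, π v}) (t - 1) (c - 1)).card else 0 := by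
  split_ifs with h
  · obtain ⟨t', rfl⟩ : ∃ t', t = t' + 1 := ⟨t - 1, by omega⟩
    obtain ⟨c', rfl⟩ : ∃ c', c = c' + 1 := ⟨c - 1, by omega⟩
    rw [card_shellIn_half hπ hπ' hv t' c']
    simp
  · exact card_shellIn_half_eq_zero v (by omega)

/-- The full pattern at `v ∈ S`, all levels: `#{U ∈ Shell_S(t,c) : v, πv ∈ U}` is `|Shell_{S∖e_v}(t−2,c)|`
if `t ≥ 2` and `0` otherwise. [cite: Rothvoss2017, §2 (PDF p. 6)] -/
theorem card_filter_full_eq_ite {S : Finset (Fin n)} (hS : ∀ v ∈ S, π v ∈ S) {v : Fin n} (hv : v ∈ S)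
    (t c : ℕ) :
    ((shellIn π S t c).filter fun U => v ∈ U ∧ π v ∈ U).card =
      if 2 ≤ t then (shellIn π (S \ {v, π v}) (t - 2) c).card else 0 := by
  split_ifs with h
  · obtain ⟨t', rfl⟩ : ∃ t', t = t' + 2 := ⟨t - 2, by omega⟩
    rw [card_shellIn_full hπ hπ' hS hv t' c, Nat.add_sub_cancel]
  · exact card_shellIn_full_eq_zero hπ' v (by omega)

/-- Shells of one-edge-deleted ground sets have the same size for every deleted edge.
[cite: Rothvoss2017, §2 (PDF p. 6)] -/
theorem card_shellIn_sdiff_pair_eq {S : Finset (Fin n)} (hS : ∀ v ∈ S, π v ∈ S) {v w : Fin n} (hv : v ∈ S)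
    (hw : w ∈ S) (t c : ℕ) :
    (shellIn π (S \ {v, π v}) t c).card = (shellIn π (S \ {w, π w}) t c).card := by
  have h1 := card_sdiff_pair hπ' hS hv
  have h2 := card_sdiff_pair hπ' hS hw
  exact card_shellIn_eq_of_card_eq hπ hπ' _ rfl (by omega) (sdiff_pair_stable hπ hS v)
    (sdiff_pair_stable hπ hS w) t c

/-- **Vertex-transitivity in counting form**: `#{U ∈ Shell_S(t,c) : v ∈ U}` is the same for all `v ∈ S`.
[cite: Rothvoss2017, §2 (PDF p. 6)] -/
theorem card_filter_mem_eq_of_mem {S : Finset (Fin n)} (hS : ∀ v ∈ S, π v ∈ S) {v w : Fin n} (hv : v ∈ S)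
    (hw : w ∈ S) (t c : ℕ) :
    ((shellIn π S t c).filter fun U => v ∈ U).card = ((shellIn π S t c).filter fun U => w ∈ U).card := by
  rw [card_filter_mem_eq_half_add_full, card_filter_mem_eq_half_add_full,
    card_filter_half_eq_ite hπ hπ' hv, card_filter_half_eq_ite hπ hπ' hw,
    card_filter_full_eq_ite hπ hπ' hS hv, card_filter_full_eq_ite hπ hπ' hS hw]
  split_ifs <;>
    simp [card_shellIn_sdiff_pair_eq hπ hπ' hS hv hw]

omit hπ hπ' in
/-- Double count: `Σ_{v ∈ S} #{U ∈ Shell_S(t,c) : v ∈ U} = t · |Shell_S(t,c)|`. [cite: Rothvoss2017, §2 (PDF p. 6)] -/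
theorem sum_card_filter_mem (S : Finset (Fin n)) (t c : ℕ) :
    ∑ v ∈ S, ((shellIn π S t c).filter fun U => v ∈ U).card = t * (shellIn π S t c).card := by
  simp_rw [card_filter]
  rw [sum_comm]
  have : ∀ U ∈ shellIn π S t c, ∑ v ∈ S, (if v ∈ U then 1 else 0) = t := by
    intro U hU
    obtain ⟨hUS, hUt, -⟩ := mem_shellIn.1 hU
    rw [← sum_filter, filter_mem_eq_inter, inter_eq_right.2 hUS, sum_const, smul_eq_mul, mul_one, hUt]
  rw [sum_congr rfl this, sum_const, smul_eq_mul, mul_comm]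

/-- **The mean, one vertex**: `|S| · #{U ∈ Shell_S(t,c) : v ∈ U} = t · |Shell_S(t,c)|` for every `v ∈ S`.
[cite: Rothvoss2017, §2 (PDF p. 6)] -/
theorem card_mul_card_filter_mem {S : Finset (Fin n)} (hS : ∀ v ∈ S, π v ∈ S) {v : Fin n} (hv : v ∈ S)
    (t c : ℕ) :
    S.card * ((shellIn π S t c).filter fun U => v ∈ U).card = t * (shellIn π S t c).card := by
  rw [← sum_card_filter_mem S t c, ← sum_congr rfl fun w hw => card_filter_mem_eq_of_mem hπ hπ' hS hv hw t c,
    sum_const, smul_eq_mul]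

/-- **Invariance of the one-vertex count**: for `π`-stable ground sets of the same size and any vertices
`w₁ ∈ S₁`, `w₂ ∈ S₂`: `#{W ∈ Shell_{S₁}(t,c) : w₁ ∈ W} = #{W ∈ Shell_{S₂}(t,c) : w₂ ∈ W}`.
[cite: Rothvoss2017, §2 (PDF p. 6)] -/
theorem card_filter_mem_eq_of_card_eq {S₁ S₂ : Finset (Fin n)} (hS₁ : ∀ v ∈ S₁, π v ∈ S₁)
    (hS₂ : ∀ v ∈ S₂, π v ∈ S₂) (hcard : S₁.card = S₂.card) {w₁ w₂ : Fin n} (hw₁ : w₁ ∈ S₁) (hw₂ : w₂ ∈ S₂)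
    (t c : ℕ) :
    ((shellIn π S₁ t c).filter fun W => w₁ ∈ W).card = ((shellIn π S₂ t c).filter fun W => w₂ ∈ W).card := by
  have h1 := card_mul_card_filter_mem hπ hπ' hS₁ hw₁ t c
  have h2 := card_mul_card_filter_mem hπ hπ' hS₂ hw₂ t c
  have hZ : (shellIn π S₁ t c).card = (shellIn π S₂ t c).card :=
    card_shellIn_eq_of_card_eq hπ hπ' _ hcard rfl hS₁ hS₂ t c
  rw [hZ, ← h2, hcard] at h1
  exact Nat.eq_of_mul_eq_mul_left (card_pos.2 ⟨w₂, hw₂⟩) h1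

/-! ### §2 One edge: `#{U : v, πv ∈ U}` does not depend on the edge; `|S|·#{U : v,πv ∈ U} = (t−c)·|Shell|` -/

/-- **Edge-transitivity in counting form**: `#{U ∈ Shell_S(t,c) : v, πv ∈ U}` is the same for all `v ∈ S`.
[cite: Rothvoss2017, §2 (PDF p. 6)] -/
theorem card_filter_full_eq_of_mem {S : Finset (Fin n)} (hS : ∀ v ∈ S, π v ∈ S) {v w : Fin n} (hv : v ∈ S)
    (hw : w ∈ S) (t c : ℕ) :
    ((shellIn π S t c).filter fun U => v ∈ U ∧ π v ∈ U).card =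
      ((shellIn π S t c).filter fun U => w ∈ U ∧ π w ∈ U).card := by
  rw [card_filter_full_eq_ite hπ hπ' hS hv, card_filter_full_eq_ite hπ hπ' hS hw]
  split_ifs <;> simp [card_shellIn_sdiff_pair_eq hπ hπ' hS hv hw]

omit hπ hπ' in
/-- Double count: `Σ_{v ∈ S} #{U ∈ Shell_S(t,c) : v, πv ∈ U} = (t − c) · |Shell_S(t,c)|` (every cut of the shell
has `t − c` fully matched vertices). [cite: Rothvoss2017, §2 (PDF p. 6)] -/
theorem sum_card_filter_full (S : Finset (Fin n)) (t c : ℕ) :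
    ∑ v ∈ S, ((shellIn π S t c).filter fun U => v ∈ U ∧ π v ∈ U).card = (t - c) * (shellIn π S t c).card := by
  simp_rw [card_filter]
  rw [sum_comm]
  have : ∀ U ∈ shellIn π S t c, ∑ v ∈ S, (if v ∈ U ∧ π v ∈ U then 1 else 0) = t - c := by
    intro U hU
    obtain ⟨hUS, -, -⟩ := mem_shellIn.1 hU
    rw [← sum_filter, ← card_eq_sum_ones, ← card_full_of_mem_shellIn hU]
    congr 1
    ext w
    simp only [mem_filter, mem_full]
    exact ⟨fun h => h.2, fun h => ⟨hUS h.1, h⟩⟩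
  rw [sum_congr rfl this, sum_const, smul_eq_mul, mul_comm]

/-- **One edge**: `|S| · #{U ∈ Shell_S(t,c) : v, πv ∈ U} = (t − c) · |Shell_S(t,c)|` for every `v ∈ S` (the
edge at `v` is full in a fraction `s/N` of the shell). [cite: Rothvoss2017, §2 (PDF p. 6)] -/
theorem card_mul_card_filter_full {S : Finset (Fin n)} (hS : ∀ v ∈ S, π v ∈ S) {v : Fin n} (hv : v ∈ S)
    (t c : ℕ) :
    S.card * ((shellIn π S t c).filter fun U => v ∈ U ∧ π v ∈ U).card = (t - c) * (shellIn π S t c).card := by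
  rw [← sum_card_filter_full S t c, ← sum_congr rfl fun w hw => card_filter_full_eq_of_mem hπ hπ' hS hv hw t c,
    sum_const, smul_eq_mul]

/-! ### §3 Two vertices on different edges: `#{U : v, w ∈ U}` does not depend on the pair -/

/-- The pair count through the pattern at `e_v`: for `v ∈ S` and `w ∈ S ∖ e_v`,
`#{U : v, w ∈ U} = [t,c ≥ 1]·#{W ∈ Shell_{S∖e_v}(t−1,c−1) : w ∈ W} + [t ≥ 2]·#{W ∈ Shell_{S∖e_v}(t−2,c) : w ∈ W}`
(`v` half-matched: `U = W ∪ {v}`; `v` fully matched: `U = W ∪ e_v`). [cite: Rothvoss2017, §2 (PDF p. 6)] -/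
theorem card_filter_pair_eq {S : Finset (Fin n)} (hS : ∀ v ∈ S, π v ∈ S) {v w : Fin n} (hv : v ∈ S)
    (hw : w ∈ S \ {v, π v}) (t c : ℕ) :
    ((shellIn π S t c).filter fun U => v ∈ U ∧ w ∈ U).card =
      (if 1 ≤ t ∧ 1 ≤ c then ((shellIn π (S \ {v, π v}) (t - 1) (c - 1)).filter fun W => w ∈ W).card else 0) +
        (if 2 ≤ t then ((shellIn π (S \ {v, π v}) (t - 2) c).filter fun W => w ∈ W).card else 0) := by
  have hwv : w ≠ v := by
    intro h; rw [mem_sdiff, mem_insert] at hw; exact hw.2 (Or.inl h)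
  have hwπ : w ≠ π v := by
    intro h; rw [mem_sdiff, mem_insert, mem_singleton] at hw; exact hw.2 (Or.inr h)
  -- split the pair count by the status of `π v`
  have hsplit : ((shellIn π S t c).filter fun U => v ∈ U ∧ w ∈ U).card =
      ((shellIn π S t c).filter fun U => v ∈ U ∧ π v ∉ U ∧ w ∈ U.erase v).card +
        ((shellIn π S t c).filter fun U => v ∈ U ∧ π v ∈ U ∧ w ∈ U \ {v, π v}).card := by
    rw [← card_filter_add_card_filter_not (s := (shellIn π S t c).filter fun U => v ∈ U ∧ w ∈ U)
      (fun U => π v ∉ U), filter_filter, filter_filter]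
    congr 2
    · ext U
      simp only [mem_filter, mem_erase]
      tauto
    · ext U
      simp only [mem_filter, mem_sdiff, mem_insert, mem_singleton, not_or, not_not]
      tauto
  rw [hsplit]
  congr 1
  · split_ifs with h
    · obtain ⟨t', rfl⟩ : ∃ t', t = t' + 1 := ⟨t - 1, by omega⟩
      obtain ⟨c', rfl⟩ : ∃ c', c = c' + 1 := ⟨c - 1, by omega⟩
      rw [card_shellIn_half_filter hπ hπ' hv t' c' (fun W => w ∈ W)]
      simp
    · rw [card_eq_zero, filter_eq_empty_iff]
      intro U hU hc
      have h0 := card_shellIn_half_eq_zero (π := π) (S := S) v (t := t) (c := c) (by omega)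
      rw [card_eq_zero, filter_eq_empty_iff] at h0
      exact h0 hU ⟨hc.1, hc.2.1⟩
  · split_ifs with h
    · obtain ⟨t', rfl⟩ : ∃ t', t = t' + 2 := ⟨t - 2, by omega⟩
      rw [card_shellIn_full_filter hπ hπ' hS hv t' c (fun W => w ∈ W), Nat.add_sub_cancel]
    · rw [card_eq_zero, filter_eq_empty_iff]
      intro U hU hc
      have h0 := card_shellIn_full_eq_zero hπ' (S := S) v (t := t) (c := c) (by omega)
      rw [card_eq_zero, filter_eq_empty_iff] at h0
      exact h0 hU ⟨hc.1, hc.2.1⟩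

/-- **Pair-transitivity in counting form**: `#{U ∈ Shell_S(t,c) : v, w ∈ U}` is the same for all pairs
`v ∈ S`, `w ∈ S ∖ e_v` of vertices on different edges. [cite: Rothvoss2017, §2 (PDF p. 6)] -/
theorem card_filter_pair_eq_of_mem {S : Finset (Fin n)} (hS : ∀ v ∈ S, π v ∈ S) {v w v' w' : Fin n}
    (hv : v ∈ S) (hw : w ∈ S \ {v, π v}) (hv' : v' ∈ S) (hw' : w' ∈ S \ {v', π v'}) (t c : ℕ) :
    ((shellIn π S t c).filter fun U => v ∈ U ∧ w ∈ U).card =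
      ((shellIn π S t c).filter fun U => v' ∈ U ∧ w' ∈ U).card := by
  have hc1 := card_sdiff_pair hπ' hS hv
  have hc2 := card_sdiff_pair hπ' hS hv'
  have hcard : (S \ {v, π v}).card = (S \ {v', π v'}).card := by omega
  rw [card_filter_pair_eq hπ hπ' hS hv hw, card_filter_pair_eq hπ hπ' hS hv' hw']
  have e1 := card_filter_mem_eq_of_card_eq hπ hπ' (sdiff_pair_stable hπ hS v) (sdiff_pair_stable hπ hS v')
    hcard hw hw'
  split_ifs <;> simp [e1]

omit hπ in
/-- Double count: `Σ_{v ∈ S} Σ_{w ∈ S ∖ e_v} #{U ∈ Shell_S(t,c) : v, w ∈ U} = (t(t−1) − (t−c)) · |Shell_S(t,c)|`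
(in a cut `U` of the shell a vertex `v ∈ U` has `t − 1 − [πv ∈ U]` companions off its own edge, and
`Σ_{v∈U} [πv ∈ U] = |full(U)| = t − c`). [cite: Rothvoss2017, §2 (PDF p. 6)] -/
theorem sum_sum_card_filter_pair (S : Finset (Fin n)) (t c : ℕ) :
    ((∑ v ∈ S, ∑ w ∈ S \ {v, π v}, ((shellIn π S t c).filter fun U => v ∈ U ∧ w ∈ U).card : ℕ) : ℝ) =
      ((t : ℝ) * (t - 1) - (t - c)) * (shellIn π S t c).card := by
  have key : ∀ U ∈ shellIn π S t c,
      ((∑ v ∈ S, ∑ w ∈ S \ {v, π v}, (if v ∈ U ∧ w ∈ U then 1 else 0 : ℕ) : ℕ) : ℝ) =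
        (t : ℝ) * (t - 1) - (t - c) := by
    intro U hU
    obtain ⟨hUS, hUt, -⟩ := mem_shellIn.1 hU
    have hct : c ≤ t := le_of_mem_shellIn hU
    have hfull := card_full_of_mem_shellIn hU
    -- inner sum for `v ∈ U`: the companions of `v` in `U` off its edge
    have inner : ∀ v ∈ S, (∑ w ∈ S \ {v, π v}, (if v ∈ U ∧ w ∈ U then 1 else 0 : ℕ)) =
        if v ∈ U then (U \ {v, π v}).card else 0 := by
      intro v hv
      split_ifs with hvU
      · rw [← sum_filter, ← card_eq_sum_ones]
        congr 1; ext w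
        simp only [mem_filter, mem_sdiff, hvU, true_and]
        exact ⟨fun h => ⟨h.2, h.1.2⟩, fun h => ⟨⟨hUS h.1, h.2⟩, h.1⟩⟩
      · simp [hvU]
    rw [sum_congr rfl inner, ← sum_filter, filter_mem_eq_inter, inter_eq_right.2 hUS]
    -- `|U ∖ e_v| = t − 1 − [πv ∈ U]`
    have hv1 : ∀ v ∈ U, ((U \ {v, π v}).card : ℝ) = (t : ℝ) - 1 - (if π v ∈ U then 1 else 0) := by
      intro v hvU
      have hsub : U ∩ {v, π v} = if π v ∈ U then {v, π v} else {v} := by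
        split_ifs with h
        · exact inter_eq_right.2 (by
            intro u hu; rcases mem_insert.1 hu with rfl | hu
            · exact hvU
            · rw [mem_singleton] at hu; rw [hu]; exact h)
        · ext u
          simp only [mem_inter, mem_insert, mem_singleton]
          constructor
          · rintro ⟨hu, rfl | rfl⟩
            · rfl
            · exact absurd hu h
          · rintro rfl; exact ⟨hvU, Or.inl rfl⟩
      have hc := card_sdiff_add_card_inter U {v, π v}
      rw [hsub] at hc
      split_ifs at hc ⊢ with h
      · rw [card_pair (hπ' v).symm] at hc
        have : ((U \ {v, π v}).card : ℝ) + 2 = t := by rw [← hUt]; exact_mod_cast hc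
        linarith
      · rw [card_singleton] at hc
        have : ((U \ {v, π v}).card : ℝ) + 1 = t := by rw [← hUt]; exact_mod_cast hc
        linarith
    push_cast
    rw [sum_congr rfl hv1, sum_sub_distrib, sum_const, nsmul_eq_mul, hUt]
    have hf : ∑ v ∈ U, (if π v ∈ U then (1 : ℝ) else 0) = ((full π U).card : ℝ) := by
      rw [← sum_filter]
      simp only [sum_const, nsmul_eq_mul, mul_one]
      congr 1
    rw [hf, hfull, Nat.cast_sub hct]
  simp_rw [card_filter]
  push_cast
  rw [show (∑ v ∈ S, ∑ w ∈ S \ {v, π v}, ∑ U ∈ shellIn π S t c, (if v ∈ U ∧ w ∈ U then (1 : ℝ) else 0)) =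
      ∑ U ∈ shellIn π S t c, ∑ v ∈ S, ∑ w ∈ S \ {v, π v}, (if v ∈ U ∧ w ∈ U then (1 : ℝ) else 0) by
    rw [sum_comm]; exact sum_congr rfl fun v _ => sum_comm]
  have key' : ∀ U ∈ shellIn π S t c,
      ∑ v ∈ S, ∑ w ∈ S \ {v, π v}, (if v ∈ U ∧ w ∈ U then (1 : ℝ) else 0) = (t : ℝ) * (t - 1) - (t - c) := by
    intro U hU
    have := key U hU
    push_cast at this
    exact this
  rw [sum_congr rfl key', sum_const, nsmul_eq_mul, mul_comm]

/-- **Two vertices on different edges**: `|S|(|S|−2) · #{U ∈ Shell_S(t,c) : v, w ∈ U} = (t(t−1) − (t−c)) · |Shell|`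
for every `v ∈ S`, `w ∈ S ∖ e_v`. [cite: Rothvoss2017, §2 (PDF p. 6)] -/
theorem card_mul_card_filter_pair {S : Finset (Fin n)} (hS : ∀ v ∈ S, π v ∈ S) {v w : Fin n} (hv : v ∈ S)
    (hw : w ∈ S \ {v, π v}) (t c : ℕ) :
    (S.card : ℝ) * ((S.card : ℝ) - 2) * ((shellIn π S t c).filter fun U => v ∈ U ∧ w ∈ U).card =
      ((t : ℝ) * (t - 1) - (t - c)) * (shellIn π S t c).card := by
  rw [← sum_sum_card_filter_pair hπ' S t c]
  have hconst : ∀ v' ∈ S, (∑ w' ∈ S \ {v', π v'}, ((shellIn π S t c).filter fun U => v' ∈ U ∧ w' ∈ U).card) =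
      (S.card - 2) * ((shellIn π S t c).filter fun U => v ∈ U ∧ w ∈ U).card := by
    intro v' hv'
    rw [sum_congr rfl fun w' hw' => card_filter_pair_eq_of_mem hπ hπ' hS hv' hw' hv hw t c, sum_const,
      smul_eq_mul]
    have := card_sdiff_pair hπ' hS hv'
    congr 1; omega
  rw [sum_congr rfl hconst, sum_const, smul_eq_mul]
  have h2 : 2 ≤ S.card := by have := card_sdiff_pair hπ' hS hv; omega
  push_cast [Nat.cast_sub h2]
  ring

/-! ### §4 The moments of the block statistic -/

omit hπ hπ' in
/-- The block statistic as a sum of indicators over `S ∩ H` (for a cut inside `S`). [cite: Rothvoss2017, §2 (PDF p. 5)] -/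
theorem card_inter_eq_sum_ite {S H U : Finset (Fin n)} (hU : U ⊆ S) :
    ((U ∩ H).card : ℝ) = ∑ v ∈ S ∩ H, (if v ∈ U then (1 : ℝ) else 0) := by
  rw [← sum_filter, sum_const, nsmul_eq_mul, mul_one]
  congr 2
  ext v
  simp only [mem_inter, mem_filter]
  exact ⟨fun h => ⟨⟨hU h.1, h.2⟩, h.1⟩, fun h => ⟨h.2, h.1.2⟩⟩

omit hπ hπ' in
/-- No shell below the level: `Shell_S(t,c) = ∅` for `t < c`. [cite: Rothvoss2017, §2 (PDF p. 6)] -/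
theorem card_shellIn_eq_zero_of_lt {S : Finset (Fin n)} {t c : ℕ} (h : t < c) : (shellIn π S t c).card = 0 := by
  rw [card_eq_zero]
  exact eq_empty_of_forall_notMem fun U hU => absurd (le_of_mem_shellIn hU) (by omega)

/-- **One edge, real form**: `|S| · #{U : v, πv ∈ U} = (t − c) · |Shell_S(t,c)|` with the real difference `t − c`
(both sides vanish below the level). [cite: Rothvoss2017, §2 (PDF p. 6)] -/
theorem card_mul_card_filter_full_real {S : Finset (Fin n)} (hS : ∀ v ∈ S, π v ∈ S) {v : Fin n} (hv : v ∈ S)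
    (t c : ℕ) :
    (S.card : ℝ) * (((shellIn π S t c).filter fun U => v ∈ U ∧ π v ∈ U).card : ℝ) =
      ((t : ℝ) - c) * (shellIn π S t c).card := by
  have h := card_mul_card_filter_full hπ hπ' hS hv t c
  by_cases hct : c ≤ t
  · have : ((S.card * ((shellIn π S t c).filter fun U => v ∈ U ∧ π v ∈ U).card : ℕ) : ℝ) =
        (((t - c) * (shellIn π S t c).card : ℕ) : ℝ) := by rw [h]
    push_cast [Nat.cast_sub hct] at this
    exact this
  · rw [not_le] at hct
    have hZ := card_shellIn_eq_zero_of_lt (π := π) (S := S) hct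
    have h0 : ((shellIn π S t c).filter fun U => v ∈ U ∧ π v ∈ U).card = 0 := by
      rw [← Nat.le_zero, ← hZ]; exact card_filter_le _ _
    rw [hZ, h0]; push_cast; ring

/-- **THE MEAN of the block statistic under the shell measure**: `|S| · Σ_{U ∈ Shell_S(t,c)} |U∩H| = |S∩H|·t·|Shell_S(t,c)|`,
i.e. `E[|U∩H|] = t·|S∩H|/|S|` at EVERY level `c`. [cite: Rothvoss2017, §2 (PDF p. 6)] -/
theorem card_mul_sum_card_inter {S : Finset (Fin n)} (hS : ∀ v ∈ S, π v ∈ S) (H : Finset (Fin n)) (t c : ℕ) :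
    (S.card : ℝ) * ∑ U ∈ shellIn π S t c, ((U ∩ H).card : ℝ) =
      ((S ∩ H).card : ℝ) * t * (shellIn π S t c).card := by
  rw [sum_congr rfl fun U hU => card_inter_eq_sum_ite (H := H) (mem_shellIn.1 hU).1, sum_comm]
  have hP : ∀ v ∈ S ∩ H, (S.card : ℝ) * ∑ U ∈ shellIn π S t c, (if v ∈ U then (1 : ℝ) else 0) =
      (t : ℝ) * (shellIn π S t c).card := by
    intro v hv
    rw [← sum_filter, sum_const, nsmul_eq_mul, mul_one]
    exact_mod_cast card_mul_card_filter_mem hπ hπ' hS (mem_inter.1 hv).1 t c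
  rw [mul_sum, sum_congr rfl hP, sum_const, nsmul_eq_mul]
  ring

/-- **THE SECOND MOMENT of the block statistic under the shell measure** (eng MEMO-21 (★)): with `h = |S∩H|` and
`A = |vAA_S(H)|` (vertices of `S ∩ H` whose partner is in `H`),
`|S|(|S|−2) · Σ_{U ∈ Shell_S(t,c)} |U∩H|² = |Shell| · ((|S|−2)(t·h + (t−c)·A) + (t(t−1) − (t−c))·(h(h−1) − A))`.
[cite: Rothvoss2017, §2 (PDF p. 6)] -/
theorem sum_card_inter_sq {S : Finset (Fin n)} (hS : ∀ v ∈ S, π v ∈ S) (H : Finset (Fin n)) (t c : ℕ) :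
    (S.card : ℝ) * ((S.card : ℝ) - 2) * ∑ U ∈ shellIn π S t c, ((U ∩ H).card : ℝ) ^ 2 =
      ((shellIn π S t c).card : ℝ) *
        (((S.card : ℝ) - 2) * ((t : ℝ) * (S ∩ H).card + ((t : ℝ) - c) * (vAA π S H).card) +
          ((t : ℝ) * (t - 1) - (t - c)) * (((S ∩ H).card : ℝ) * ((S ∩ H).card - 1) - (vAA π S H).card)) := by
  classical
  -- notation
  set T := shellIn π S t c with hT
  set P : Fin n → Fin n → ℝ := fun v w => ((T.filter fun U => v ∈ U ∧ w ∈ U).card : ℝ) with hPdef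
  -- Step 1: `Σ_U X² = Σ_{v,w ∈ S∩H} P v w`
  have hsq : ∑ U ∈ T, ((U ∩ H).card : ℝ) ^ 2 = ∑ v ∈ S ∩ H, ∑ w ∈ S ∩ H, P v w := by
    have e1 : ∀ U ∈ T, ((U ∩ H).card : ℝ) ^ 2 =
        ∑ v ∈ S ∩ H, ∑ w ∈ S ∩ H, (if v ∈ U ∧ w ∈ U then (1 : ℝ) else 0) := by
      intro U hU
      rw [card_inter_eq_sum_ite (H := H) (mem_shellIn.1 hU).1, sq, sum_mul_sum]
      refine sum_congr rfl fun v _ => sum_congr rfl fun w _ => ?_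
      by_cases hv : v ∈ U <;> by_cases hw : w ∈ U <;> simp [hv, hw]
    rw [sum_congr rfl e1, sum_comm]
    refine sum_congr rfl fun v _ => ?_
    rw [sum_comm]
    refine sum_congr rfl fun w _ => ?_
    rw [hPdef]
    simp only
    rw [← sum_filter, sum_const, nsmul_eq_mul, mul_one]
  -- Step 2: the three kinds of pairs, for a fixed `v ∈ S ∩ H`
  have hrow : ∀ v ∈ S ∩ H, (S.card : ℝ) * ((S.card : ℝ) - 2) * ∑ w ∈ S ∩ H, P v w =
      ((S.card : ℝ) - 2) * ((t : ℝ) * T.card) +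
        (if π v ∈ H then (1 : ℝ) else 0) * (((S.card : ℝ) - 2) * (((t : ℝ) - c) * T.card)) +
        (((S ∩ H).card : ℝ) - 1 - (if π v ∈ H then (1 : ℝ) else 0)) *
          (((t : ℝ) * (t - 1) - (t - c)) * T.card) := by
    intro v hvH
    have hv : v ∈ S := (mem_inter.1 hvH).1
    have hvπ : v ≠ π v := (hπ' v).symm
    -- the remainder set `R = (S ∩ H) ∖ e_v`
    have hR : ∀ w ∈ (S ∩ H) \ {v, π v}, w ∈ S \ {v, π v} := fun w hw => by
      rw [mem_sdiff] at hw ⊢; exact ⟨(mem_inter.1 hw.1).1, hw.2⟩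
    -- split the sum over `w`
    have hsplit : ∑ w ∈ S ∩ H, P v w =
        P v v + (if π v ∈ H then P v (π v) else 0) + ∑ w ∈ (S ∩ H) \ {v, π v}, P v w := by
      rw [← add_sum_erase (S ∩ H) (P v) hvH]
      by_cases hπvH : π v ∈ H
      · have hπv : π v ∈ (S ∩ H).erase v := by
          rw [mem_erase, mem_inter]; exact ⟨hvπ.symm, hS v hv, hπvH⟩
        rw [← add_sum_erase _ (P v) hπv, if_pos hπvH]
        have e : ((S ∩ H).erase v).erase (π v) = (S ∩ H) \ {v, π v} := by
          ext w; simp only [mem_erase, mem_sdiff, mem_insert, mem_singleton, not_or]; tauto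
        rw [e]; ring
      · rw [if_neg hπvH]
        have e : (S ∩ H).erase v = (S ∩ H) \ {v, π v} := by
          ext w
          simp only [mem_erase, mem_sdiff, mem_insert, mem_singleton, not_or, mem_inter]
          constructor
          · rintro ⟨hwv, hwS, hwH⟩
            exact ⟨⟨hwS, hwH⟩, hwv, fun h => hπvH (h ▸ hwH)⟩
          · rintro ⟨⟨hwS, hwH⟩, hwv, _⟩; exact ⟨hwv, hwS, hwH⟩
        rw [e]; ring
    -- the cardinality of `R`
    have hRcard : (((S ∩ H) \ {v, π v}).card : ℝ) = ((S ∩ H).card : ℝ) - 1 - (if π v ∈ H then (1 : ℝ) else 0) := by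
      have hc := card_sdiff_add_card_inter (S ∩ H) {v, π v}
      have hsub : (S ∩ H) ∩ {v, π v} = if π v ∈ H then {v, π v} else {v} := by
        split_ifs with h
        · exact inter_eq_right.2 (by
            intro u hu; rcases mem_insert.1 hu with rfl | hu
            · exact hvH
            · rw [mem_singleton] at hu; rw [hu]; exact mem_inter.2 ⟨hS v hv, h⟩)
        · ext u
          simp only [mem_inter, mem_insert, mem_singleton]
          constructor
          · rintro ⟨⟨-, huH⟩, rfl | rfl⟩
            · rfl
            · exact absurd huH h
          · rintro rfl; exact ⟨⟨hv, (mem_inter.1 hvH).2⟩, Or.inl rfl⟩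
      rw [hsub] at hc
      split_ifs at hc ⊢ with h
      · rw [card_pair hvπ] at hc
        have : (((S ∩ H) \ {v, π v}).card : ℝ) + 2 = (S ∩ H).card := by exact_mod_cast hc
        linarith
      · rw [card_singleton] at hc
        have : (((S ∩ H) \ {v, π v}).card : ℝ) + 1 = (S ∩ H).card := by exact_mod_cast hc
        linarith
    -- the three evaluations
    have f1 : (S.card : ℝ) * P v v = (t : ℝ) * T.card := by
      have e : (T.filter fun U => v ∈ U ∧ v ∈ U) = T.filter fun U => v ∈ U := by
        congr 1; ext U; exact and_self_iff
      rw [hPdef]; simp only; rw [e]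
      exact_mod_cast card_mul_card_filter_mem hπ hπ' hS hv t c
    have f2 : (S.card : ℝ) * P v (π v) = ((t : ℝ) - c) * T.card := by
      rw [hPdef]; exact card_mul_card_filter_full_real hπ hπ' hS hv t c
    have f3 : ∀ w ∈ (S ∩ H) \ {v, π v}, (S.card : ℝ) * ((S.card : ℝ) - 2) * P v w =
        ((t : ℝ) * (t - 1) - (t - c)) * T.card := fun w hw => by
      rw [hPdef]; exact card_mul_card_filter_pair hπ hπ' hS hv (hR w hw) t c
    rw [hsplit, mul_add, mul_add, mul_sum, sum_congr rfl f3, sum_const, nsmul_eq_mul, hRcard]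
    have e2 : (S.card : ℝ) * ((S.card : ℝ) - 2) * (if π v ∈ H then P v (π v) else 0) =
        (if π v ∈ H then (1 : ℝ) else 0) * (((S.card : ℝ) - 2) * (((t : ℝ) - c) * T.card)) := by
      split_ifs
      · rw [← f2]; ring
      · ring
    rw [e2, show (S.card : ℝ) * ((S.card : ℝ) - 2) * P v v = ((S.card : ℝ) - 2) * ((S.card : ℝ) * P v v) by ring,
      f1]
  -- Step 3: sum over `v ∈ S ∩ H`
  have hA : ∑ v ∈ S ∩ H, (if π v ∈ H then (1 : ℝ) else 0) = ((vAA π S H).card : ℝ) := by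
    rw [← sum_filter, sum_const, nsmul_eq_mul, mul_one]
    congr 2
    ext v
    simp only [mem_filter, mem_inter, vAA]
    tauto
  rw [hsq, mul_sum, sum_congr rfl hrow, sum_add_distrib, sum_add_distrib, sum_const, nsmul_eq_mul,
    ← sum_mul, ← sum_mul, hA, sum_sub_distrib, sum_sub_distrib, sum_const, nsmul_eq_mul, sum_const,
    nsmul_eq_mul, mul_one, hA]
  ring

/-- **The second moment in normalised form** (`|S| ≥ 3`; eng MEMO-21 (★) for `S` = all vertices, `|S| = n`,
`A = 2a`, `t − c = 2s`: `E[X²] = h t/n + 2a·s/N + (h(h−1) − 2a)(t(t−1) − 2s)/(n(n−2))`):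
`Σ_{U ∈ Shell} |U∩H|² = |Shell| · ( (t h + (t−c)A)/|S| + (t(t−1) − (t−c))(h(h−1) − A)/(|S|(|S|−2)) )`.
[cite: Rothvoss2017, §2 (PDF p. 6)] -/
theorem sum_card_inter_sq_div {S : Finset (Fin n)} (hS : ∀ v ∈ S, π v ∈ S) (H : Finset (Fin n)) (t c : ℕ)
    (h3 : 3 ≤ S.card) :
    ∑ U ∈ shellIn π S t c, ((U ∩ H).card : ℝ) ^ 2 =
      ((shellIn π S t c).card : ℝ) *
        (((t : ℝ) * (S ∩ H).card + ((t : ℝ) - c) * (vAA π S H).card) / S.card +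
          ((t : ℝ) * (t - 1) - (t - c)) * (((S ∩ H).card : ℝ) * ((S ∩ H).card - 1) - (vAA π S H).card) /
            ((S.card : ℝ) * ((S.card : ℝ) - 2))) := by
  have h := sum_card_inter_sq hπ hπ' hS H t c
  have hS0 : (0 : ℝ) < S.card := by exact_mod_cast (show 0 < S.card by omega)
  have hS2 : (0 : ℝ) < (S.card : ℝ) - 2 := by
    have : (3 : ℝ) ≤ S.card := by exact_mod_cast h3
    linarith
  field_simp
  linear_combination h

/-! ### §5 The mixed moment of two block statistics (cell pnp-psdrank, lit g36; eng g23's menu item (ii)) -/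

omit hπ in
/-- Sums over `(S ∩ H₂) ∩ e_v` for `v ∈ S`: the edge `e_v = {v, πv}` meets `S ∩ H₂` in `[v ∈ H₂] + [πv ∈ H₂]`
points. [cite: Rothvoss2017, §2 (PDF p. 5)] -/
theorem sum_inter_pair_eq {S H₂ : Finset (Fin n)} (hS : ∀ v ∈ S, π v ∈ S) {v : Fin n} (hv : v ∈ S)
    (f : Fin n → ℝ) :
    ∑ w ∈ (S ∩ H₂) ∩ {v, π v}, f w = (if v ∈ H₂ then f v else 0) + (if π v ∈ H₂ then f (π v) else 0) := by
  classical
  have hvπ : v ≠ π v := (hπ' v).symm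
  rw [inter_comm, ← filter_mem_eq_inter, sum_filter, sum_pair hvπ]
  simp only [mem_inter, hv, hS v hv, true_and]

/-- **THE MIXED MOMENT of two block statistics under the shell measure.** For blocks `H₁, H₂` (not necessarily
disjoint), with `h_i = |S ∩ H_i|`, `h₁₂ = |S ∩ H₁ ∩ H₂|` and `A₁₂ = #{v ∈ S ∩ H₁ : πv ∈ H₂}` (the number of
`H₁H₂` edges, an `H₁ ∩ H₂`–`H₁ ∩ H₂` edge counted twice):
`|S|(|S|−2) · Σ_{U ∈ Shell_S(t,c)} |U∩H₁|·|U∩H₂| = |Shell| · ((|S|−2)(t·h₁₂ + (t−c)·A₁₂) + (t(t−1) − (t−c))·(h₁h₂ − h₁₂ − A₁₂))`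
— the same three counts as the second moment (`H₁ = H₂` recovers `sum_card_inter_sq`); for DISJOINT blocks
`E[X₁X₂] = (t−c)A₁₂/|S| + (t(t−1) − (t−c))(h₁h₂ − A₁₂)/(|S|(|S|−2))`, the input of the two-block covariance
`ΔΣ₁₂` of eng MEMO-21 §4. [cite: Rothvoss2017, §2 (PDF p. 6)] -/
theorem sum_card_inter_mul_card_inter {S : Finset (Fin n)} (hS : ∀ v ∈ S, π v ∈ S) (H₁ H₂ : Finset (Fin n))
    (t c : ℕ) :
    (S.card : ℝ) * ((S.card : ℝ) - 2) * ∑ U ∈ shellIn π S t c, ((U ∩ H₁).card : ℝ) * ((U ∩ H₂).card : ℝ) =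
      ((shellIn π S t c).card : ℝ) *
        (((S.card : ℝ) - 2) * ((t : ℝ) * (S ∩ H₁ ∩ H₂).card +
            ((t : ℝ) - c) * ((S ∩ H₁).filter fun v => π v ∈ H₂).card) +
          ((t : ℝ) * (t - 1) - (t - c)) *
            (((S ∩ H₁).card : ℝ) * (S ∩ H₂).card - (S ∩ H₁ ∩ H₂).card -
              ((S ∩ H₁).filter fun v => π v ∈ H₂).card)) := by
  classical
  -- notation
  set T := shellIn π S t c with hT
  set P : Fin n → Fin n → ℝ := fun v w => ((T.filter fun U => v ∈ U ∧ w ∈ U).card : ℝ) with hPdef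
  -- Step 1: `Σ_U X₁X₂ = Σ_{v ∈ S∩H₁} Σ_{w ∈ S∩H₂} P v w`
  have hsq : ∑ U ∈ T, ((U ∩ H₁).card : ℝ) * ((U ∩ H₂).card : ℝ) = ∑ v ∈ S ∩ H₁, ∑ w ∈ S ∩ H₂, P v w := by
    have e1 : ∀ U ∈ T, ((U ∩ H₁).card : ℝ) * ((U ∩ H₂).card : ℝ) =
        ∑ v ∈ S ∩ H₁, ∑ w ∈ S ∩ H₂, (if v ∈ U ∧ w ∈ U then (1 : ℝ) else 0) := by
      intro U hU
      rw [card_inter_eq_sum_ite (H := H₁) (mem_shellIn.1 hU).1, card_inter_eq_sum_ite (H := H₂) (mem_shellIn.1 hU).1,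
        sum_mul_sum]
      refine sum_congr rfl fun v _ => sum_congr rfl fun w _ => ?_
      by_cases hv : v ∈ U <;> by_cases hw : w ∈ U <;> simp [hv, hw]
    rw [sum_congr rfl e1, sum_comm]
    refine sum_congr rfl fun v _ => ?_
    rw [sum_comm]
    refine sum_congr rfl fun w _ => ?_
    rw [hPdef]
    simp only
    rw [← sum_filter, sum_const, nsmul_eq_mul, mul_one]
  -- Step 2: the three kinds of pairs, for a fixed `v ∈ S ∩ H₁`
  have hrow : ∀ v ∈ S ∩ H₁, (S.card : ℝ) * ((S.card : ℝ) - 2) * ∑ w ∈ S ∩ H₂, P v w =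
      (if v ∈ H₂ then (1 : ℝ) else 0) * (((S.card : ℝ) - 2) * ((t : ℝ) * T.card)) +
        (if π v ∈ H₂ then (1 : ℝ) else 0) * (((S.card : ℝ) - 2) * (((t : ℝ) - c) * T.card)) +
        (((S ∩ H₂).card : ℝ) - (if v ∈ H₂ then (1 : ℝ) else 0) - (if π v ∈ H₂ then (1 : ℝ) else 0)) *
          (((t : ℝ) * (t - 1) - (t - c)) * T.card) := by
    intro v hvH
    have hv : v ∈ S := (mem_inter.1 hvH).1
    -- the remainder set `R = (S ∩ H₂) ∖ e_v`
    have hR : ∀ w ∈ (S ∩ H₂) \ {v, π v}, w ∈ S \ {v, π v} := fun w hw => by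
      rw [mem_sdiff] at hw ⊢; exact ⟨(mem_inter.1 hw.1).1, hw.2⟩
    -- split the sum over `w` along `e_v`
    have hsplit : ∑ w ∈ S ∩ H₂, P v w =
        (if v ∈ H₂ then P v v else 0) + (if π v ∈ H₂ then P v (π v) else 0) +
          ∑ w ∈ (S ∩ H₂) \ {v, π v}, P v w := by
      rw [← sum_inter_add_sum_sdiff (S ∩ H₂) {v, π v} (P v), sum_inter_pair_eq hπ' hS hv]
    -- the cardinality of `R`
    have hRcard : (((S ∩ H₂) \ {v, π v}).card : ℝ) =
        ((S ∩ H₂).card : ℝ) - (if v ∈ H₂ then (1 : ℝ) else 0) - (if π v ∈ H₂ then (1 : ℝ) else 0) := by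
      have hc := card_sdiff_add_card_inter (S ∩ H₂) {v, π v}
      have hI : (((S ∩ H₂) ∩ {v, π v}).card : ℝ) = (if v ∈ H₂ then (1 : ℝ) else 0) + (if π v ∈ H₂ then (1 : ℝ) else 0) := by
        rw [card_eq_sum_ones, Nat.cast_sum, sum_inter_pair_eq hπ' hS hv]
        push_cast
        rfl
      have : (((S ∩ H₂) \ {v, π v}).card : ℝ) + (((S ∩ H₂) ∩ {v, π v}).card : ℝ) = (S ∩ H₂).card := by
        exact_mod_cast hc
      linarith
    -- the three evaluations
    have f1 : (S.card : ℝ) * P v v = (t : ℝ) * T.card := by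
      have e : (T.filter fun U => v ∈ U ∧ v ∈ U) = T.filter fun U => v ∈ U := by
        congr 1; ext U; exact and_self_iff
      rw [hPdef]; simp only; rw [e]
      exact_mod_cast card_mul_card_filter_mem hπ hπ' hS hv t c
    have f2 : (S.card : ℝ) * P v (π v) = ((t : ℝ) - c) * T.card := by
      rw [hPdef]; exact card_mul_card_filter_full_real hπ hπ' hS hv t c
    have f3 : ∀ w ∈ (S ∩ H₂) \ {v, π v}, (S.card : ℝ) * ((S.card : ℝ) - 2) * P v w =
        ((t : ℝ) * (t - 1) - (t - c)) * T.card := fun w hw => by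
      rw [hPdef]; exact card_mul_card_filter_pair hπ hπ' hS hv (hR w hw) t c
    rw [hsplit, mul_add, mul_add, mul_sum, sum_congr rfl f3, sum_const, nsmul_eq_mul, hRcard]
    have e1 : (S.card : ℝ) * ((S.card : ℝ) - 2) * (if v ∈ H₂ then P v v else 0) =
        (if v ∈ H₂ then (1 : ℝ) else 0) * (((S.card : ℝ) - 2) * ((t : ℝ) * T.card)) := by
      split_ifs
      · rw [← f1]; ring
      · ring
    have e2 : (S.card : ℝ) * ((S.card : ℝ) - 2) * (if π v ∈ H₂ then P v (π v) else 0) =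
        (if π v ∈ H₂ then (1 : ℝ) else 0) * (((S.card : ℝ) - 2) * (((t : ℝ) - c) * T.card)) := by
      split_ifs
      · rw [← f2]; ring
      · ring
    rw [e1, e2]
  -- Step 3: sum over `v ∈ S ∩ H₁`
  have hA : ∑ v ∈ S ∩ H₁, (if π v ∈ H₂ then (1 : ℝ) else 0) = (((S ∩ H₁).filter fun v => π v ∈ H₂).card : ℝ) := by
    rw [← sum_filter, sum_const, nsmul_eq_mul, mul_one]
  have hB : ∑ v ∈ S ∩ H₁, (if v ∈ H₂ then (1 : ℝ) else 0) = ((S ∩ H₁ ∩ H₂).card : ℝ) := by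
    rw [← sum_filter, sum_const, nsmul_eq_mul, mul_one, filter_mem_eq_inter]
  rw [hsq, mul_sum, sum_congr rfl hrow, sum_add_distrib, sum_add_distrib, ← sum_mul, ← sum_mul, ← sum_mul, hA, hB,
    sum_sub_distrib, sum_sub_distrib, sum_const, nsmul_eq_mul, hA, hB]
  ring

omit hπ' in
/-- **The number of `H₁H₂` edges is symmetric**: `#{v ∈ S ∩ H₁ : πv ∈ H₂} = #{w ∈ S ∩ H₂ : πw ∈ H₁}` (the
partner map). [cite: Rothvoss2017, §2 (PDF p. 5)] -/
theorem card_filter_partner_comm {S : Finset (Fin n)} (hS : ∀ v ∈ S, π v ∈ S) (H₁ H₂ : Finset (Fin n)) :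
    ((S ∩ H₁).filter fun v => π v ∈ H₂).card = ((S ∩ H₂).filter fun w => π w ∈ H₁).card := by
  classical
  have hinj : Function.Injective π := fun a b h => by rw [← hπ a, ← hπ b, h]
  rw [← card_image_of_injective ((S ∩ H₁).filter fun v => π v ∈ H₂) hinj]
  congr 1
  ext w
  simp only [mem_image, mem_filter, mem_inter]
  constructor
  · rintro ⟨v, ⟨⟨hvS, hvH⟩, hπv⟩, rfl⟩
    exact ⟨⟨hS v hvS, hπv⟩, by rw [hπ]; exact hvH⟩
  · rintro ⟨⟨hwS, hwH⟩, hπw⟩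
    exact ⟨π w, ⟨⟨hS w hwS, hπw⟩, by rw [hπ]; exact hwH⟩, hπ w⟩

/-- **The mixed moment for DISJOINT blocks**: with `A₁₂ = #{v ∈ S ∩ H₁ : πv ∈ H₂}` the number of `H₁H₂` edges,
`|S|(|S|−2) · Σ_{U ∈ Shell_S(t,c)} |U∩H₁|·|U∩H₂| = |Shell| · ((|S|−2)(t−c)·A₁₂ + (t(t−1) − (t−c))·(h₁h₂ − A₁₂))`.
[cite: Rothvoss2017, §2 (PDF p. 6)] -/
theorem sum_card_inter_mul_card_inter_of_disjoint {S : Finset (Fin n)} (hS : ∀ v ∈ S, π v ∈ S)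
    {H₁ H₂ : Finset (Fin n)} (hdis : Disjoint H₁ H₂) (t c : ℕ) :
    (S.card : ℝ) * ((S.card : ℝ) - 2) * ∑ U ∈ shellIn π S t c, ((U ∩ H₁).card : ℝ) * ((U ∩ H₂).card : ℝ) =
      ((shellIn π S t c).card : ℝ) *
        (((S.card : ℝ) - 2) * (((t : ℝ) - c) * ((S ∩ H₁).filter fun v => π v ∈ H₂).card) +
          ((t : ℝ) * (t - 1) - (t - c)) *
            (((S ∩ H₁).card : ℝ) * (S ∩ H₂).card - ((S ∩ H₁).filter fun v => π v ∈ H₂).card)) := by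
  have h0 : S ∩ H₁ ∩ H₂ = ∅ := by
    rw [inter_assoc, disjoint_iff_inter_eq_empty.1 hdis, inter_empty]
  rw [sum_card_inter_mul_card_inter hπ hπ' hS H₁ H₂ t c, h0, card_empty]
  push_cast
  ring

/-- **The mixed moment for disjoint blocks in normalised form** (`|S| ≥ 3`):
`Σ_{U ∈ Shell} |U∩H₁|·|U∩H₂| = |Shell| · ((t−c)A₁₂/|S| + (t(t−1) − (t−c))(h₁h₂ − A₁₂)/(|S|(|S|−2)))`
— with `|S| = n = 2N`, `t − c = 2s`: `E[X₁X₂] = s·A₁₂/N + (t(t−1) − 2s)(h₁h₂ − A₁₂)/(n(n−2))`, so that with the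
means `t h_i/n` (`card_mul_sum_card_inter`) the covariance of the two block statistics is explicit.
[cite: Rothvoss2017, §2 (PDF p. 6)] -/
theorem sum_card_inter_mul_card_inter_div {S : Finset (Fin n)} (hS : ∀ v ∈ S, π v ∈ S)
    {H₁ H₂ : Finset (Fin n)} (hdis : Disjoint H₁ H₂) (t c : ℕ) (h3 : 3 ≤ S.card) :
    ∑ U ∈ shellIn π S t c, ((U ∩ H₁).card : ℝ) * ((U ∩ H₂).card : ℝ) =
      ((shellIn π S t c).card : ℝ) *
        ((((t : ℝ) - c) * ((S ∩ H₁).filter fun v => π v ∈ H₂).card) / S.card +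
          ((t : ℝ) * (t - 1) - (t - c)) *
              (((S ∩ H₁).card : ℝ) * (S ∩ H₂).card - ((S ∩ H₁).filter fun v => π v ∈ H₂).card) /
            ((S.card : ℝ) * ((S.card : ℝ) - 2))) := by
  have h := sum_card_inter_mul_card_inter_of_disjoint hπ hπ' hS hdis t c
  have hS0 : (0 : ℝ) < S.card := by exact_mod_cast (show 0 < S.card by omega)
  have hS2 : (0 : ℝ) < (S.card : ℝ) - 2 := by
    have : (3 : ℝ) ≤ S.card := by exact_mod_cast h3
    linarith
  field_simp
  linear_combination h

/-- **The covariance numerator for disjoint blocks.** In the notation above, with `|Shell| > 0` and `|S| ≥ 3`,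
`E[X₁X₂] − E[X₁]E[X₂] = (t−c)A₁₂/|S| + (t(t−1) − (t−c))(h₁h₂ − A₁₂)/(|S|(|S|−2)) − t²h₁h₂/|S|²`
(expectations under the uniform shell measure, written as `Σ_U(·)/|Shell|`). [cite: Rothvoss2017, §2 (PDF p. 6)] -/
theorem shellCov_of_disjoint {S : Finset (Fin n)} (hS : ∀ v ∈ S, π v ∈ S)
    {H₁ H₂ : Finset (Fin n)} (hdis : Disjoint H₁ H₂) (t c : ℕ) (h3 : 3 ≤ S.card)
    (hT : 0 < (shellIn π S t c).card) :
    (∑ U ∈ shellIn π S t c, ((U ∩ H₁).card : ℝ) * ((U ∩ H₂).card : ℝ)) / (shellIn π S t c).card -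
        ((∑ U ∈ shellIn π S t c, ((U ∩ H₁).card : ℝ)) / (shellIn π S t c).card) *
          ((∑ U ∈ shellIn π S t c, ((U ∩ H₂).card : ℝ)) / (shellIn π S t c).card) =
      ((t : ℝ) - c) * ((S ∩ H₁).filter fun v => π v ∈ H₂).card / S.card +
          ((t : ℝ) * (t - 1) - (t - c)) *
              (((S ∩ H₁).card : ℝ) * (S ∩ H₂).card - ((S ∩ H₁).filter fun v => π v ∈ H₂).card) /
            ((S.card : ℝ) * ((S.card : ℝ) - 2)) -
        (t : ℝ) ^ 2 * (S ∩ H₁).card * (S ∩ H₂).card / (S.card : ℝ) ^ 2 := by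
  have h := sum_card_inter_mul_card_inter_of_disjoint hπ hπ' hS hdis t c
  have m1 := card_mul_sum_card_inter hπ hπ' hS H₁ t c
  have m2 := card_mul_sum_card_inter hπ hπ' hS H₂ t c
  have hS0 : (0 : ℝ) < S.card := by exact_mod_cast (show 0 < S.card by omega)
  have hS2 : (0 : ℝ) < (S.card : ℝ) - 2 := by
    have : (3 : ℝ) ≤ S.card := by exact_mod_cast h3
    linarith
  have hT0 : (0 : ℝ) < (shellIn π S t c).card := by exact_mod_cast hT
  have e1 : (∑ U ∈ shellIn π S t c, ((U ∩ H₁).card : ℝ)) = ((S ∩ H₁).card : ℝ) * t * (shellIn π S t c).card / S.card := by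
    rw [eq_div_iff hS0.ne', mul_comm]; exact m1
  have e2 : (∑ U ∈ shellIn π S t c, ((U ∩ H₂).card : ℝ)) = ((S ∩ H₂).card : ℝ) * t * (shellIn π S t c).card / S.card := by
    rw [eq_div_iff hS0.ne', mul_comm]; exact m2
  rw [sum_card_inter_mul_card_inter_div hπ hπ' hS hdis t c h3, e1, e2]
  field_simp

end Moments

end ShellStep

end Literature.Combinatorics.Optimization

end
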